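import Literature.Geometry.ComplexHyperbolic.UnitBallLieAlgebraHCClosure           -- ★ (d2) FILE 1 p846595 (owner F0P3a-p05 (g15)): `isOpen_setOf_rootProduct_ne_zero`, `contDiffOn_liePhi`; brings ★ (a0)(a1)(b3-pre) (`liePhi_eq_smul_fun`, `contDiff_rootProduct`, `iteratedFDeriv_lieOrbital_torusH_apply`, `norm_22_sq_le_of_apply_conj_torusH_ne_zero`, `isCompact_setOf_norm_22_sq_le`)
import Literature.Geometry.ComplexHyperbolic.UnitBallRegularOrbitDRegimeDeriv      -- ★ (c2) p844133 (owner F0P3a-p05 (g14)): `linfty_opNorm_conj_le` (`‖Ad_g D‖ ≤ 9|g₂₂|²‖D‖`)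
import HarnessLib

/-!
# Crude jet bounds, orders `≤ 3`, for the Lie-algebra orbital integral of `U(2,1)`: `‖Dⁱφ_h(θ)‖ ≤ C'·min(|θ₀−θ₂|,|θ₁−θ₂|)⁻¹⁰` on the regular part of the unit ball
# (ROAD «A6-IV» brick (c3′); Warner II §8.4.3 Appendix, Lemma 2 — the a-priori polynomial blow-up that Harish-Chandra's bootstrap (Thm. 8.4.3.1) improves to boundedness)

Topic `Geometry/ComplexHyperbolic`; namespace `Literature.Geometry.ComplexHyperbolic.BallModel`.  THEOREMS ONLY (no `def`, no instance, no notation, no axiom, no named fact, no `sorry`).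
Cell `pub/hodgecm-mathlib`, ENGINE T1 (crux H413 = `stmt-HodgeConjecture-24833`); ROAD A, design of record `DESIGN-A6-InHouse-v2-ArchitectureIV` 93542b84 (LEAD T11-4), SPEC fb65bd65 brick (c3′)
«CRUDE JET BOUNDS, ORDERS ≤ 3», owner word R-15.10 (3) (consumer shape §6); author F0P3a-p09 (g2) (hands under ROAD A owner F0P3a-p05 (g15)), 2026-09-01.

THE MATHEMATICS.  `μ` a measure on `U21` finite on compacta, `f ∈ C_c^∞(M₃(ℂ); E)` vanishing off `{‖X‖ ≤ R}`, `Φ_f(θ) = ∫ f(Ad_g torusH θ) dμ(g)` (★ (a0) `lieOrbital μ f (torusH θ)`),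
`φ_f = π·Φ_f` (★ (a0) `liePhi`).  Off the noncompact walls, with `0 < m ≤ min(|θ₀−θ₂|,|θ₁−θ₂|)`:
* ★ (a1) `DⁿΦ_f(θ)[v₁,…,vₙ] = ∫ Dⁿf(Ad_g torusH θ)[Ad_g torusH v₁, …, Ad_g torusH vₙ] dμ(g)` (derivatives under the integral sign);
* the integrand vanishes unless `|g₂₂|² ≤ 1 + 2R²∕m²` (★ (a1) all-regime support confinement, applied to `Dⁿf`, whose support lies in that of `f`);
* `‖Ad_g torusH v‖ ≤ 9|g₂₂|²‖torusH v‖ ≤ 9(1 + 2R²∕m²)‖v‖` there (★ (c2) `linfty_opNorm_conj_le`, §1 `norm_torusH_le`).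
Hence (§2) `‖DⁿΦ_f(θ)‖ ≤ sup‖Dⁿf‖ · (9(1 + 2R²∕m²))ⁿ · μ{g : |g₂₂|² ≤ 1 + 2R²∕m²}` — every order `n`, every regime.  With the support-volume bound `μ{|g₂₂|² ≤ 1 + ρ} ≤ Cρ²`
(Haar: ★ `exists_measure_real_setOf_norm_22_sq_le_eq`) and `m ≤ 2` inside the unit ball this is `≤ const·m⁻²ⁿ⁻⁴ ≤ const·m⁻¹⁰` for `n ≤ 3` (§3), and Leibniz with the polynomial `π`
(★ `contDiff_rootProduct`, jets bounded on the ball) gives the consumer form (§4): for `i < 4`, **`‖Dⁱφ_h(θ)‖ ≤ C'·(min(|θ₀−θ₂|,|θ₁−θ₂|)¹⁰)⁻¹`** on `{π ≠ 0} ∩ {‖θ‖ < 1}`.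
This is the a-priori estimate `|φ_f^{(i)}| ≤ c·dist(θ, walls)^{-N}` of [WarnerHASSLG2, §8.4.3 Appendix, Lemma 2] in the one place the bootstrap (d3) uses it; the exponent `10` is crude and immaterial.
HONEST LABEL: HC_CM is proved only modulo the printed citations until rung 0 closes; this file is elementary bookkeeping over ★ (a1) + ★ (c2) and pays nothing by itself.

## References
* [WarnerHASSLG2] G. Warner, *Harmonic Analysis on Semi-Simple Lie Groups II*, Grundlehren 189 (1972), §8.4.3, Appendix (Lemma 2), Thm. 8.4.3.1.
* [Varadarajan1989] V. S. Varadarajan, *An Introduction to Harmonic Analysis on Semisimple Lie Groups* (1989), §6.3.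
* [Folland1995] G. B. Folland, *A Course in Abstract Harmonic Analysis* (1995), §2.6.
-/

set_option autoImplicit false

noncomputable section

namespace Literature.Geometry.ComplexHyperbolic

namespace BallModel

open _root_.Complex _root_.Matrix _root_.MeasureTheory _root_.Set _root_.Filter _root_.Topology _root_.Metric
open scoped Matrix.Norms.Operator ContDiff

/-! ## §1 Two elementary norm facts: `‖torusH v‖ ≤ ‖v‖`; `Dⁿf` vanishes where `f` does (support radius) -/

/-- `‖torusH v‖ ≤ ‖v‖` for the `ℓ^∞`-operator norm (`torusH v = diag(i v_k)`, row sums `|v_k|`). [cite: WarnerHASSLG2, §8.4.1] -/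
theorem norm_torusH_le (v : Fin 3 → ℝ) : ‖torusH v‖ ≤ ‖v‖ := by
  have hD : torusH v = Matrix.diagonal fun k => ((v k : ℝ) : ℂ) * I := rfl
  rw [hD, Matrix.linfty_opNorm_diagonal]
  refine (pi_norm_le_iff_of_nonneg (norm_nonneg v)).2 fun k => ?_
  rw [norm_mul, Complex.norm_I, mul_one, Complex.norm_real]
  exact norm_le_pi_norm v k

/-- If `f` vanishes off `{‖X‖ ≤ R}` then so does every `Dⁿf` (`supp Dⁿf ⊆ tsupp f ⊆ closedBall 0 R`). [cite: WarnerHASSLG2, §8.4.3] -/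
theorem norm_le_of_iteratedFDeriv_ne_zero {E : Type*} [NormedAddCommGroup E] [NormedSpace ℝ E] {f : Matrix (Fin 3) (Fin 3) ℂ → E} {R : ℝ}
    (hfR : ∀ X, f X ≠ 0 → ‖X‖ ≤ R) (n : ℕ) (X : Matrix (Fin 3) (Fin 3) ℂ) (hX : iteratedFDeriv ℝ n f X ≠ 0) : ‖X‖ ≤ R := by
  have hsupp : Function.support f ⊆ closedBall (0 : Matrix (Fin 3) (Fin 3) ℂ) R := fun Y hY => mem_closedBall_zero_iff.2 (hfR Y hY)
  have hts : tsupport f ⊆ closedBall (0 : Matrix (Fin 3) (Fin 3) ℂ) R := closure_minimal hsupp isClosed_closedBall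
  exact mem_closedBall_zero_iff.1 (hts (support_iteratedFDeriv_subset n (Function.mem_support.2 hX)))

section Regular

variable {E : Type*} [NormedAddCommGroup E] [NormedSpace ℝ E] [CompleteSpace E]

/-! ## §2 The all-order crude bound for `Φ_f = lieOrbital μ f ∘ torusH` off the noncompact walls -/

/-- **CRUDE JET BOUND FOR `Φ_f`, EVERY ORDER, EVERY REGIME.**  `μ` finite on compacta, `f ∈ C_c^∞` vanishing off `{‖X‖ ≤ R}`, `‖Dⁿf‖ ≤ M` everywhere, `0 < m ≤ min(|θ₀−θ₂|,|θ₁−θ₂|)`: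
`‖Dⁿ(Φ_f)(θ)‖ ≤ M · (9(1 + 2R²∕m²))ⁿ · μ{g : |g₂₂|² ≤ 1 + 2R²∕m²}` (derivatives under the integral ★ (a1), support confinement ★ (a1), `‖Ad_g‖ ≤ 9|g₂₂|²` ★ (c2)).
[cite: WarnerHASSLG2, §8.4.3 Appendix, Lemma 2] [cite: Folland1995, Thm. 2.27] -/
theorem norm_iteratedFDeriv_lieOrbital_torusH_le (μ : Measure U21) [IsFiniteMeasureOnCompacts μ] {f : Matrix (Fin 3) (Fin 3) ℂ → E} (hf : ContDiff ℝ ∞ f) (hfc : HasCompactSupport f)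
    {R : ℝ} (hfR : ∀ X, f X ≠ 0 → ‖X‖ ≤ R) {n : ℕ} {M : ℝ} (hM : ∀ X, ‖iteratedFDeriv ℝ n f X‖ ≤ M)
    {m : ℝ} (hm : 0 < m) (θ : Fin 3 → ℝ) (hmθ : m ≤ min |θ 0 - θ 2| |θ 1 - θ 2|) :
    ‖iteratedFDeriv ℝ n (fun θ' : Fin 3 → ℝ => lieOrbital μ f (torusH θ')) θ‖ ≤
      M * (9 * (1 + 2 * R ^ 2 / m ^ 2)) ^ n * μ.real {g : U21 | ‖mat g 2 2‖ ^ 2 ≤ 1 + 2 * R ^ 2 / m ^ 2} := by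
  have h02' : m ≤ |θ 0 - θ 2| := le_trans hmθ (min_le_left _ _)
  have h12' : m ≤ |θ 1 - θ 2| := le_trans hmθ (min_le_right _ _)
  have h02 : θ 0 ≠ θ 2 := fun h => by
    rw [h, sub_self, abs_zero] at h02'
    exact absurd h02' (not_le.2 hm)
  have h12 : θ 1 ≠ θ 2 := fun h => by
    rw [h, sub_self, abs_zero] at h12'
    exact absurd h12' (not_le.2 hm)
  have hM0 : 0 ≤ M := le_trans (norm_nonneg _) (hM 0)
  have hρ : 0 ≤ 2 * R ^ 2 / m ^ 2 := by positivity
  have hK : 0 ≤ 9 * (1 + 2 * R ^ 2 / m ^ 2) := by positivity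
  have hfR' : ∀ X, iteratedFDeriv ℝ n f X ≠ 0 → ‖X‖ ≤ R := norm_le_of_iteratedFDeriv_ne_zero hfR n
  refine ContinuousMultilinearMap.opNorm_le_bound (mul_nonneg (mul_nonneg hM0 (pow_nonneg hK n)) measureReal_nonneg) fun v => ?_
  rw [iteratedFDeriv_lieOrbital_torusH_apply μ hf hfc θ h02 h12 n v]
  have hzero : ∀ g : U21, g ∉ {g : U21 | ‖mat g 2 2‖ ^ 2 ≤ 1 + 2 * R ^ 2 / m ^ 2} →
      iteratedFDeriv ℝ n f (mat g * torusH θ * mat g⁻¹) (fun i => mat g * torusH (v i) * mat g⁻¹) = 0 := by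
    intro g hg
    by_contra hne
    have hne' : iteratedFDeriv ℝ n f (mat g * torusH θ * mat g⁻¹) ≠ 0 := by
      intro h0
      apply hne
      rw [h0]
      rfl
    exact hg (norm_22_sq_le_of_apply_conj_torusH_ne_zero hfR' hm θ hmθ g hne')
  rw [← setIntegral_eq_integral_of_forall_compl_eq_zero hzero]
  have hSfin : μ {g : U21 | ‖mat g 2 2‖ ^ 2 ≤ 1 + 2 * R ^ 2 / m ^ 2} < ⊤ := (isCompact_setOf_norm_22_sq_le hρ).measure_lt_top
  calc ‖∫ g in {g : U21 | ‖mat g 2 2‖ ^ 2 ≤ 1 + 2 * R ^ 2 / m ^ 2}, iteratedFDeriv ℝ n f (mat g * torusH θ * mat g⁻¹) (fun i => mat g * torusH (v i) * mat g⁻¹) ∂μ‖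
      ≤ (M * (9 * (1 + 2 * R ^ 2 / m ^ 2)) ^ n * ∏ i, ‖v i‖) * μ.real {g : U21 | ‖mat g 2 2‖ ^ 2 ≤ 1 + 2 * R ^ 2 / m ^ 2} := by
        refine norm_setIntegral_le_of_norm_le_const hSfin fun g hg => ?_
        have hg' : ‖mat g 2 2‖ ^ 2 ≤ 1 + 2 * R ^ 2 / m ^ 2 := hg
        have hfac : ∀ i : Fin n, ‖mat g * torusH (v i) * mat g⁻¹‖ ≤ 9 * (1 + 2 * R ^ 2 / m ^ 2) * ‖v i‖ := fun i =>
          calc ‖mat g * torusH (v i) * mat g⁻¹‖ ≤ 9 * ‖mat g 2 2‖ ^ 2 * ‖torusH (v i)‖ := linfty_opNorm_conj_le g _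
            _ ≤ 9 * (1 + 2 * R ^ 2 / m ^ 2) * ‖v i‖ := by
                gcongr
                exact norm_torusH_le _
        have hprod : ∏ i, ‖mat g * torusH (v i) * mat g⁻¹‖ ≤ ∏ i, (9 * (1 + 2 * R ^ 2 / m ^ 2) * ‖v i‖) :=
          Finset.prod_le_prod (fun i _ => norm_nonneg _) fun i _ => hfac i
        calc ‖iteratedFDeriv ℝ n f (mat g * torusH θ * mat g⁻¹) (fun i => mat g * torusH (v i) * mat g⁻¹)‖
            ≤ ‖iteratedFDeriv ℝ n f (mat g * torusH θ * mat g⁻¹)‖ * ∏ i, ‖mat g * torusH (v i) * mat g⁻¹‖ := ContinuousMultilinearMap.le_opNorm _ _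
          _ ≤ M * ∏ i, (9 * (1 + 2 * R ^ 2 / m ^ 2) * ‖v i‖) := mul_le_mul (hM _) hprod (Finset.prod_nonneg fun i _ => norm_nonneg _) hM0
          _ = M * (9 * (1 + 2 * R ^ 2 / m ^ 2)) ^ n * ∏ i, ‖v i‖ := by
              rw [Finset.prod_mul_distrib, Finset.prod_const, Finset.card_univ, Fintype.card_fin]
              ring
    _ = M * (9 * (1 + 2 * R ^ 2 / m ^ 2)) ^ n * μ.real {g : U21 | ‖mat g 2 2‖ ^ 2 ≤ 1 + 2 * R ^ 2 / m ^ 2} * ∏ i, ‖v i‖ := by ring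

/-! ## §3 Inside the unit ball: `m ≤ 2`, and the volume bound `μ(S_ρ) ≤ Cρ²` turns §2 into `const · m⁻¹⁰` for orders `≤ 3` -/

/-- For `‖θ‖ < 1`: `min(|θ₀−θ₂|,|θ₁−θ₂|) ≤ 2`. [cite: WarnerHASSLG2, §8.4.3] -/
theorem min_abs_sub_le_two (θ : Fin 3 → ℝ) (hθ : ‖θ‖ < 1) : min |θ 0 - θ 2| |θ 1 - θ 2| ≤ 2 := by
  have h0 : |θ 0| < 1 := by
    have h := norm_le_pi_norm θ 0
    rw [Real.norm_eq_abs] at h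
    linarith
  have h2 : |θ 2| < 1 := by
    have h := norm_le_pi_norm θ 2
    rw [Real.norm_eq_abs] at h
    linarith
  calc min |θ 0 - θ 2| |θ 1 - θ 2| ≤ |θ 0 - θ 2| := min_le_left _ _
    _ ≤ |θ 0| + |θ 2| := abs_sub _ _
    _ ≤ 2 := by linarith

/-- The arithmetic of §3: for `0 < m ≤ 2`, `0 ≤ C`, `n ≤ 3`: `(9(1 + 2R²∕m²))ⁿ · C(2R²∕m²)² ≤ 9ⁿ · C · (4 + 2R²)⁵ · (m¹⁰)⁻¹`. [cite: WarnerHASSLG2, §8.4.3 Appendix, Lemma 2] -/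
theorem crudeJet_arith {m C R : ℝ} (hm : 0 < m) (hm2 : m ≤ 2) (hC : 0 ≤ C) {n : ℕ} (hn : n ≤ 3) :
    (9 * (1 + 2 * R ^ 2 / m ^ 2)) ^ n * (C * (2 * R ^ 2 / m ^ 2) ^ 2) ≤ 9 ^ n * C * (4 + 2 * R ^ 2) ^ 5 * (m ^ 10)⁻¹ := by
  have hmsq : 0 < m ^ 2 := by positivity
  have hm4 : m ^ 2 ≤ 4 := by nlinarith
  have hρ : 0 ≤ 2 * R ^ 2 / m ^ 2 := by positivity
  have h1 : 1 + 2 * R ^ 2 / m ^ 2 ≤ (4 + 2 * R ^ 2) / m ^ 2 := by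
    rw [add_div]
    gcongr
    rw [le_div_iff₀ hmsq, one_mul]
    exact hm4
  have h2 : 2 * R ^ 2 / m ^ 2 ≤ (4 + 2 * R ^ 2) / m ^ 2 := by
    gcongr
    linarith
  have h3 : 1 ≤ (4 + 2 * R ^ 2) / m ^ 2 := by
    rw [le_div_iff₀ hmsq, one_mul]
    nlinarith
  calc (9 * (1 + 2 * R ^ 2 / m ^ 2)) ^ n * (C * (2 * R ^ 2 / m ^ 2) ^ 2)
      ≤ (9 * ((4 + 2 * R ^ 2) / m ^ 2)) ^ n * (C * ((4 + 2 * R ^ 2) / m ^ 2) ^ 2) := by gcongr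
    _ = 9 ^ n * C * ((4 + 2 * R ^ 2) / m ^ 2) ^ (n + 2) := by
        rw [mul_pow, pow_add]
        ring
    _ ≤ 9 ^ n * C * ((4 + 2 * R ^ 2) / m ^ 2) ^ 5 := mul_le_mul_of_nonneg_left (pow_le_pow_right₀ h3 (by omega)) (by positivity)
    _ = 9 ^ n * C * (4 + 2 * R ^ 2) ^ 5 * (m ^ 10)⁻¹ := by
        rw [div_pow, ← pow_mul]
        ring

/-- **CRUDE JET BOUND FOR `Φ_h` ON THE REGULAR PART OF THE UNIT BALL, ORDERS `≤ 3`**: with the support-volume bound `μ{|g₂₂|² ≤ 1 + ρ} ≤ Cρ²` (`ρ ≥ 0`), `h ∈ C^∞` vanishing off `{‖X‖ ≤ R}`,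
`‖Dⁿh‖ ≤ M`, `n ≤ 3`: for `θ` off the noncompact walls with `‖θ‖ < 1`, `‖DⁿΦ_h(θ)‖ ≤ M·9ⁿ·C·(4 + 2R²)⁵ · (min(|θ₀−θ₂|,|θ₁−θ₂|)¹⁰)⁻¹`. [cite: WarnerHASSLG2, §8.4.3 Appendix, Lemma 2] -/
theorem norm_iteratedFDeriv_lieOrbital_torusH_le_inv_pow_ten (μ : Measure U21) [IsFiniteMeasureOnCompacts μ] {C : ℝ}
    (hC : ∀ ρ : ℝ, 0 ≤ ρ → μ.real {g : U21 | ‖mat g 2 2‖ ^ 2 ≤ 1 + ρ} ≤ C * ρ ^ 2)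
    {h : Matrix (Fin 3) (Fin 3) ℂ → E} (hh : ContDiff ℝ ∞ h) {R : ℝ} (hhR : ∀ X, h X ≠ 0 → ‖X‖ ≤ R) {n : ℕ} (hn : n ≤ 3) {M : ℝ} (hM : ∀ X, ‖iteratedFDeriv ℝ n h X‖ ≤ M)
    (θ : Fin 3 → ℝ) (h02 : θ 0 ≠ θ 2) (h12 : θ 1 ≠ θ 2) (hθ : ‖θ‖ < 1) :
    ‖iteratedFDeriv ℝ n (fun θ' : Fin 3 → ℝ => lieOrbital μ h (torusH θ')) θ‖ ≤
      M * 9 ^ n * C * (4 + 2 * R ^ 2) ^ 5 * ((min |θ 0 - θ 2| |θ 1 - θ 2|) ^ 10)⁻¹ := by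
  have hhc : HasCompactSupport h :=
    HasCompactSupport.of_support_subset_isCompact (isCompact_closedBall (0 : Matrix (Fin 3) (Fin 3) ℂ) R) fun X hX => mem_closedBall_zero_iff.2 (hhR X hX)
  have hm : 0 < min |θ 0 - θ 2| |θ 1 - θ 2| := lt_min (abs_pos.2 (sub_ne_zero.2 h02)) (abs_pos.2 (sub_ne_zero.2 h12))
  have hm2 : min |θ 0 - θ 2| |θ 1 - θ 2| ≤ 2 := min_abs_sub_le_two θ hθ
  have hC0 : 0 ≤ C := by
    have h1 := hC 1 zero_le_one
    rw [one_pow, mul_one] at h1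
    exact le_trans measureReal_nonneg h1
  have hM0 : 0 ≤ M := le_trans (norm_nonneg _) (hM 0)
  have hρ : 0 ≤ 2 * R ^ 2 / (min |θ 0 - θ 2| |θ 1 - θ 2|) ^ 2 := by positivity
  calc ‖iteratedFDeriv ℝ n (fun θ' : Fin 3 → ℝ => lieOrbital μ h (torusH θ')) θ‖
      ≤ M * (9 * (1 + 2 * R ^ 2 / (min |θ 0 - θ 2| |θ 1 - θ 2|) ^ 2)) ^ n * μ.real {g : U21 | ‖mat g 2 2‖ ^ 2 ≤ 1 + 2 * R ^ 2 / (min |θ 0 - θ 2| |θ 1 - θ 2|) ^ 2} :=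
        norm_iteratedFDeriv_lieOrbital_torusH_le μ hh hhc hhR hM hm θ le_rfl
    _ ≤ M * (9 * (1 + 2 * R ^ 2 / (min |θ 0 - θ 2| |θ 1 - θ 2|) ^ 2)) ^ n * (C * (2 * R ^ 2 / (min |θ 0 - θ 2| |θ 1 - θ 2|) ^ 2) ^ 2) :=
        mul_le_mul_of_nonneg_left (hC _ hρ) (mul_nonneg hM0 (pow_nonneg (by positivity) n))
    _ = M * ((9 * (1 + 2 * R ^ 2 / (min |θ 0 - θ 2| |θ 1 - θ 2|) ^ 2)) ^ n * (C * (2 * R ^ 2 / (min |θ 0 - θ 2| |θ 1 - θ 2|) ^ 2) ^ 2)) := by ring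
    _ ≤ M * (9 ^ n * C * (4 + 2 * R ^ 2) ^ 5 * ((min |θ 0 - θ 2| |θ 1 - θ 2|) ^ 10)⁻¹) := mul_le_mul_of_nonneg_left (crudeJet_arith hm hm2 hC0 hn) hM0
    _ = M * 9 ^ n * C * (4 + 2 * R ^ 2) ^ 5 * ((min |θ 0 - θ 2| |θ 1 - θ 2|) ^ 10)⁻¹ := by ring

/-! ## §4 The consumer form: Leibniz with `π` — `‖Dⁱφ_h(θ)‖ ≤ C'·(min(|θ₀−θ₂|,|θ₁−θ₂|)¹⁰)⁻¹` on `{π ≠ 0} ∩ {‖θ‖ < 1}`, `i < 4` -/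

/-- **CRUDE JET BOUNDS, ORDERS `≤ 3` (brick (c3′), consumer shape).**  `μ` finite on compacta with `μ{g : |g₂₂|² ≤ 1 + ρ} ≤ Cρ²` for `ρ ≥ 0` (Haar: ★ `exists_measure_real_setOf_norm_22_sq_le_eq`),
`h ∈ C^∞(M₃(ℂ); E)` vanishing off `{‖X‖ ≤ R}`, `i < 4`: there is `C' ≥ 0` with `‖Dⁱ(liePhi μ h)(θ)‖ ≤ C'·(min(|θ₀−θ₂|,|θ₁−θ₂|)¹⁰)⁻¹` for every `θ` with `rootProduct θ ≠ 0`, `‖θ‖ < 1`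
(Leibniz for `φ_h = π·Φ_h` on the open regular set, §3 for `Φ_h`, jets of `π` bounded on the ball). [cite: WarnerHASSLG2, §8.4.3 Appendix, Lemma 2] -/
theorem exists_norm_iteratedFDeriv_liePhi_le_inv_pow_ten (μ : Measure U21) [IsFiniteMeasureOnCompacts μ] {C : ℝ}
    (hC : ∀ ρ : ℝ, 0 ≤ ρ → μ.real {g : U21 | ‖mat g 2 2‖ ^ 2 ≤ 1 + ρ} ≤ C * ρ ^ 2)
    {h : Matrix (Fin 3) (Fin 3) ℂ → E} (hh : ContDiff ℝ ∞ h) {R : ℝ} (hhR : ∀ X, h X ≠ 0 → ‖X‖ ≤ R) {i : ℕ} (hi : i < 4) :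
    ∃ C' : ℝ, 0 ≤ C' ∧ ∀ θ : Fin 3 → ℝ, rootProduct θ ≠ 0 → ‖θ‖ < 1 →
      ‖iteratedFDeriv ℝ i (liePhi μ h) θ‖ ≤ C' * ((min |θ 0 - θ 2| |θ 1 - θ 2|) ^ 10)⁻¹ := by
  have hhc : HasCompactSupport h :=
    HasCompactSupport.of_support_subset_isCompact (isCompact_closedBall (0 : Matrix (Fin 3) (Fin 3) ℂ) R) fun X hX => mem_closedBall_zero_iff.2 (hhR X hX)
  have hMk : ∀ k : ℕ, ∃ M : ℝ, ∀ X, ‖iteratedFDeriv ℝ k h X‖ ≤ M := fun k =>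
    (hh.continuous_iteratedFDeriv (m := k) (mod_cast le_top)).bounded_above_of_compact_support (hhc.iteratedFDeriv k)
  choose Mf hMf using hMk
  have hPk : ∀ k : ℕ, ∃ P : ℝ, ∀ θ ∈ closedBall (0 : Fin 3 → ℝ) 1, ‖iteratedFDeriv ℝ k rootProduct θ‖ ≤ P := fun k =>
    (isCompact_closedBall (0 : Fin 3 → ℝ) 1).exists_bound_of_continuousOn (contDiff_rootProduct.continuous_iteratedFDeriv (m := k) (mod_cast le_top)).continuousOn
  choose Pf hPf using hPk
  refine ⟨∑ j ∈ Finset.range (i + 1), (i.choose j : ℝ) * |Pf j| * |Mf (i - j) * 9 ^ (i - j) * C * (4 + 2 * R ^ 2) ^ 5|,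
    Finset.sum_nonneg fun j _ => by positivity, fun θ hθr hθ1 => ?_⟩
  obtain ⟨-, h02, h12⟩ := (rootProduct_ne_zero_iff θ).1 hθr
  have hm : 0 < min |θ 0 - θ 2| |θ 1 - θ 2| := lt_min (abs_pos.2 (sub_ne_zero.2 h02)) (abs_pos.2 (sub_ne_zero.2 h12))
  have hU : IsOpen {θ : Fin 3 → ℝ | rootProduct θ ≠ 0} := isOpen_setOf_rootProduct_ne_zero
  have hθU : θ ∈ {θ : Fin 3 → ℝ | rootProduct θ ≠ 0} := hθr
  have hΦ : ContDiffOn ℝ ∞ (fun θ' : Fin 3 → ℝ => lieOrbital μ h (torusH θ')) {θ : Fin 3 → ℝ | rootProduct θ ≠ 0} := fun θ' hθ' =>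
    (contDiffAt_lieOrbital_torusH μ hh hhc θ' ((rootProduct_ne_zero_iff θ').1 hθ').2.1 ((rootProduct_ne_zero_iff θ').1 hθ').2.2).contDiffWithinAt
  have hπ : ContDiffOn ℝ ∞ rootProduct {θ : Fin 3 → ℝ | rootProduct θ ≠ 0} := contDiff_rootProduct.contDiffOn
  have key := norm_iteratedFDerivWithin_smul_le (𝕜 := ℝ) hπ hΦ hU.uniqueDiffOn hθU (n := i) (mod_cast le_top)
  rw [iteratedFDerivWithin_of_isOpen i hU hθU] at key
  rw [liePhi_eq_smul_fun μ h]
  refine key.trans ?_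
  rw [Finset.sum_mul]
  refine Finset.sum_le_sum fun j hj => ?_
  have hj : j ≤ i := Nat.lt_succ_iff.1 (Finset.mem_range.1 hj)
  rw [iteratedFDerivWithin_of_isOpen j hU hθU, iteratedFDerivWithin_of_isOpen (i - j) hU hθU]
  have hπj : ‖iteratedFDeriv ℝ j rootProduct θ‖ ≤ |Pf j| := (hPf j θ (mem_closedBall_zero_iff.2 hθ1.le)).trans (le_abs_self _)
  have hΦj : ‖iteratedFDeriv ℝ (i - j) (fun θ' : Fin 3 → ℝ => lieOrbital μ h (torusH θ')) θ‖ ≤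
      |Mf (i - j) * 9 ^ (i - j) * C * (4 + 2 * R ^ 2) ^ 5| * ((min |θ 0 - θ 2| |θ 1 - θ 2|) ^ 10)⁻¹ :=
    (norm_iteratedFDeriv_lieOrbital_torusH_le_inv_pow_ten μ hC hh hhR (n := i - j) (by omega) (hMf (i - j)) θ h02 h12 hθ1).trans
      (mul_le_mul_of_nonneg_right (le_abs_self _) (by positivity))
  calc (i.choose j : ℝ) * ‖iteratedFDeriv ℝ j rootProduct θ‖ * ‖iteratedFDeriv ℝ (i - j) (fun θ' : Fin 3 → ℝ => lieOrbital μ h (torusH θ')) θ‖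
      ≤ (i.choose j : ℝ) * |Pf j| * (|Mf (i - j) * 9 ^ (i - j) * C * (4 + 2 * R ^ 2) ^ 5| * ((min |θ 0 - θ 2| |θ 1 - θ 2|) ^ 10)⁻¹) := by gcongr
    _ = (i.choose j : ℝ) * |Pf j| * |Mf (i - j) * 9 ^ (i - j) * C * (4 + 2 * R ^ 2) ^ 5| * ((min |θ 0 - θ 2| |θ 1 - θ 2|) ^ 10)⁻¹ := by ring

end Regular

end BallModel

end Literature.Geometry.ComplexHyperbolic
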